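import Literature.Probability.LatticeModels.ProdBernoulliBK
import Literature.Probability.Percolation.TwoSetExchange
import HarnessLib

/-!
# `NoHeavyLowerTail` (stmt-CriticalPhenomena-4575) — the random-core pair exchange RC1 on STEINER-FREE supports,
# by a two-copy coordinate swap

Support file (prover `prim-lf-1`, lemma factory #1: coupling / BK–Reimer; `--supports stmt-CriticalPhenomena-4575`).
No definitions, no named facts, no sorries.

Setting of `…CoreExchange.lean` (FloatingSink section): `μ = prodBernoulli w` on `Fin n`, observer `o`, floating relays
`a, b`, a core `R` with anchor `c ∈ R`, `Γ = ⋂_{r ∈ R} {c ↔ r}` ("the core is internally connected"),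
`S_a = μ(Γ ∩ {o↮a} ∩ {o↮c} ∩ {o↔b})`, `T_a = μ(Γ ∩ {o↮a} ∩ {a↮c})` and symmetrically in `b`.  The RANDOM-CORE PAIR
EXCHANGE RC1 `S_a · S_b ≤ T_a · T_b` (seat memo CANDIDATES.md, batch 1; for `R = {c}` it is
`Theorems.worstPairExchange_two`, one instance of BHK 2006 Thm 1.5; with a larger core it is NOT reachable by BHK's
conditioning proof, memo batch 5) is proved here for every weight vector whenever the vertex set is STEINER-FREE, i.e.
every vertex is one of `o, a, b` or a core vertex (`steinerFree_corePairExchange`).  Fed into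
`CoreExchange.eventGluing_pair_within` / `CoreExchange.worstFirst_two_mul_within` (tree) it gives the floating-sink
event gluing REG₂ and worst-first packing RWF₂ on such supports (e.g. the whole `{o, a₁, …, a₅}` cell of the `(5,2)`
rung with the giant pinned to any triple of relays).

PROOF (memo batch 6).  TWO-COPY SWAP: for configurations `ω₁ ∈ S_a`, `ω₂ ∈ S_b` let `η₁` take the edges AT `o` from
`ω₁` and all other edges from `ω₂`, and `η₂` the other way round.  Then `η₁ ∈ T_a`: the core paths of `ω₂` avoid `o`
(as `o ↮ c` in `ω₂`), so `Γ` transfers (`reach_transfer_of_avoids`); and `a` is ISOLATED in `η₁`: an edge `a–o` open in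
`η₁` is open in `ω₁`, contradicting `o ↮ a` there; an edge `a–w`, `w ≠ o`, open in `η₁` is open in `ω₂`, so
`w ∈ C_{ω₂}(a) = C_{ω₂}(o)`, which contains neither `b` nor a core vertex — and there are no other vertices
(`hybrid_mem_T`).  Symmetrically `η₂ ∈ T_b`.  The swap `(ω₁, ω₂) ↦ (η₁, η₂)` is an involution of the pair space that
preserves the product weight (`pairWeight_swap`), so the weighted pair sum over `S_a × S_b` is at most the one over
`T_a × T_b` (`sum_pair_le_of_swap`); the four probabilities are such pair sums by the cylinder expansion
`prodBernoulli_real_eq_sum_cube` (`prodBernoulli_pair_le_of_swap`).  In van den Berg–Gandolfi's language this is a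
folding-by-folding injection (the swap acts inside every folding; cf. `Literature.….ProductMeasureFoldings`).
With a Steiner vertex `z` adjacent to `o` the fixed swap fails (entangled `z`: `(o,z)` open in `ω₁`, `z ↔ a` in `ω₂`);
the general RC1 is open (0 violations and 0 deficient foldings in the censuses, memo batches 1, 4).
-/

noncomputable section

namespace Summit.CriticalPhenomena.PercolationContinuityZ3.Theorems

open MeasureTheory Set Literature.Probability.LatticeModels Literature.Probability.Percolation
open scoped Classical BigOperators

namespace CoreExchange

/-! ### Pointwise combinatorics of the swap -/

section Pointwise

variable {V : Type*}

/-- A vertex with no open edge reaches only itself. [folklore] -/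
theorem eq_of_reachable_of_isolated {η : BondConfig V} {a v : V}
    (hiso : ∀ w, ¬ (openGraph η).Adj a w) (h : (openGraph η).Reachable a v) : v = a := by
  obtain ⟨p⟩ := h
  cases p with
  | nil => rfl
  | cons hadj _ => exact absurd hadj (hiso _)

/-- **Transfer of the core connection.**  If `c ↮ o` in `ω` and every edge of `ω` avoiding `o` is open in `η`,
then every vertex joined to `c` in `ω` is joined to `c` in `η` (the `c`-cluster of `ω` avoids `o`, so its edges are
open in `η`). [folklore] -/
theorem reach_transfer_of_avoids {ω η : BondConfig V} {o c r : V}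
    (hco : ¬ (openGraph ω).Reachable c o) (hη : ∀ e ∈ ω, o ∉ e → e ∈ η)
    (h : (openGraph ω).Reachable c r) : (openGraph η).Reachable c r := by
  have hsub : openEdgeCluster ω c ⊆ η := by
    intro e he
    obtain ⟨heω, -, hreach⟩ := (mem_openEdgeCluster_iff ω c e).1 he
    exact hη e heω fun ho => hco (hreach o ho)
  have hcl := TwoSetExchange.openEdgeCluster_subset_of_subset hsub
  rw [reachable_iff_exists_mem_openEdgeCluster] at h ⊢
  rcases h with h | ⟨e, he, hre⟩
  · exact Or.inl h
  · exact Or.inr ⟨e, hcl he, hre⟩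

/-- **The hybrid lands in `T_a`** (Steiner-free vertex set: every vertex is `o`, `a`, `b` or in the core `R`;
`a ≠ o`, `a ∉ R`, `c ∈ R`).  If `o ↮ a` in `ω₁`; in `ω₂`: `o ↔ a`, `o ↮ b`, `o ↮ c` and `c ↔ r` for all `r ∈ R`; and `η`
takes the edges at `o` from `ω₁` and the others from `ω₂` — then in `η`: `c ↔ r` for all `r ∈ R`, `o ↮ a` and `a ↮ c`.
[this file] -/
theorem hybrid_mem_T {ω₁ ω₂ η : BondConfig V} {o a b c : V} {R : Finset V}
    (hV : ∀ v, v = o ∨ v = a ∨ v = b ∨ v ∈ R) (hao : a ≠ o) (haR : a ∉ R) (hcR : c ∈ R)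
    (hη : ∀ e, e ∈ η ↔ (o ∈ e ∧ e ∈ ω₁) ∨ (o ∉ e ∧ e ∈ ω₂))
    (h1oa : ¬ (openGraph ω₁).Reachable o a)
    (h2oa : (openGraph ω₂).Reachable o a) (h2ob : ¬ (openGraph ω₂).Reachable o b)
    (h2oc : ¬ (openGraph ω₂).Reachable o c) (h2Γ : ∀ r ∈ R, (openGraph ω₂).Reachable c r) :
    (∀ r ∈ R, (openGraph η).Reachable c r) ∧ ¬ (openGraph η).Reachable o a ∧
      ¬ (openGraph η).Reachable a c := by
  -- the core transfers
  have hco : ¬ (openGraph ω₂).Reachable c o := fun h => h2oc h.symm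
  have hΓ : ∀ r ∈ R, (openGraph η).Reachable c r := fun r hr =>
    reach_transfer_of_avoids hco (fun e he ho => (hη e).2 (Or.inr ⟨ho, he⟩)) (h2Γ r hr)
  -- `a` is isolated in `η`
  have hiso : ∀ w, ¬ (openGraph η).Adj a w := by
    intro w hadj
    rw [openGraph_adj] at hadj
    obtain ⟨he, haw⟩ := hadj
    rcases (hη _).1 he with ⟨ho, he1⟩ | ⟨ho, he2⟩
    · -- an edge at `o`: then `w = o` and `o ↔ a` in `ω₁`
      have hwo : w = o := by
        rcases Sym2.mem_iff.1 ho with h | h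
        · exact absurd h.symm hao
        · exact h.symm
      have he1' : s(a, o) ∈ ω₁ := by rw [← hwo]; exact he1
      exact h1oa ((openGraph_adj ω₁ a o).2 ⟨he1', hao⟩).reachable.symm
    · -- an edge avoiding `o`, open in `ω₂`: `w` lies in `C_{ω₂}(a) = C_{ω₂}(o)`
      have haw2 : (openGraph ω₂).Reachable a w := ((openGraph_adj ω₂ a w).2 ⟨he2, haw⟩).reachable
      have how2 : (openGraph ω₂).Reachable o w := h2oa.trans haw2
      rcases hV w with hw | hw | hw | hw
      · exact ho (by rw [hw]; exact Sym2.mem_mk_right a o)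
      · exact haw hw.symm
      · exact h2ob (by rw [← hw]; exact how2)
      · exact h2oc (how2.trans (h2Γ w hw).symm)
  refine ⟨hΓ, fun h => hao (eq_of_reachable_of_isolated hiso h.symm).symm, fun h => ?_⟩
  have hca : c = a := eq_of_reachable_of_isolated hiso h
  exact haR (hca ▸ hcR)

end Pointwise

/-! ### The two-copy swap on the pattern cube -/

section Swap

variable {α : Type*} [Fintype α] [DecidableEq α]

omit [DecidableEq α] in
/-- **The swap preserves the pair weight.**  For a product weight `g(y) = ∏ᵢ cᵢ(yᵢ)` and any set of coordinates
`P`, exchanging the `P`-coordinates between two patterns does not change `g(y) g(x)`. [folklore] -/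
theorem pairWeight_swap (cw : α → Bool → ℝ) (P : α → Prop) [DecidablePred P] (y x : α → Bool) :
    (∏ i, cw i ((fun i => if P i then x i else y i) i)) * ∏ i, cw i ((fun i => if P i then y i else x i) i) =
      (∏ i, cw i (y i)) * ∏ i, cw i (x i) := by
  rw [← Finset.prod_mul_distrib, ← Finset.prod_mul_distrib]
  refine Finset.prod_congr rfl fun i _ => ?_
  by_cases hP : P i
  · simp only [hP, if_true]; ring
  · simp only [hP, if_false]

omit [Fintype α] [DecidableEq α] in
/-- The swap is an involution on pairs of patterns. [folklore] -/
theorem swap_swap (P : α → Prop) [DecidablePred P] (y x : α → Bool) :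
    ((fun i => if P i then (fun i => if P i then y i else x i) i else (fun i => if P i then x i else y i) i),
      (fun i => if P i then (fun i => if P i then x i else y i) i else (fun i => if P i then y i else x i) i)) =
      (y, x) := by
  ext i <;> by_cases hP : P i <;> simp [hP]

/-- **Weighted pair sums under the swap.**  If the swap maps the pairs satisfying `L` into the pairs satisfying
`R`, then the `g ⊗ g`-weighted count of `L` is at most that of `R` (for any nonnegative product weight `g`).
This is the two-copy (van den Berg–Fiebig / Reimer type) swapping argument, folding by folding.
[cite: VandenbergGandolfi2012, proof of Thm. 13 (the decomposition into classes W)] -/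
theorem sum_pair_le_of_swap (cw : α → Bool → ℝ) (hcw : ∀ i t, 0 ≤ cw i t) (P : α → Prop) [DecidablePred P]
    (L R : (α → Bool) → (α → Bool) → Prop) [∀ y x, Decidable (L y x)] [∀ y x, Decidable (R y x)]
    (h : ∀ y x, L y x → R (fun i => if P i then x i else y i) (fun i => if P i then y i else x i)) :
    ∑ y : α → Bool, ∑ x : α → Bool, (∏ i, cw i (y i)) * (∏ i, cw i (x i)) * (if L y x then 1 else 0) ≤
      ∑ y : α → Bool, ∑ x : α → Bool, (∏ i, cw i (y i)) * (∏ i, cw i (x i)) * (if R y x then 1 else 0) := by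
  -- the swap as a permutation of the pair space
  let σf : (α → Bool) × (α → Bool) → (α → Bool) × (α → Bool) := fun q =>
    ((fun i => if P i then q.2 i else q.1 i), (fun i => if P i then q.1 i else q.2 i))
  have hinv : Function.Involutive σf := fun q => by
    obtain ⟨y, x⟩ := q
    exact swap_swap P y x
  let σ : Equiv.Perm ((α → Bool) × (α → Bool)) := hinv.toPerm σf
  have hσ : ∀ q, σ q = σf q := fun q => rfl
  -- pass to sums over the pair type
  rw [← Fintype.sum_prod_type'
      (fun (y x : α → Bool) => (∏ i, cw i (y i)) * (∏ i, cw i (x i)) * (if L y x then (1:ℝ) else 0)),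
    ← Fintype.sum_prod_type'
      (fun (y x : α → Bool) => (∏ i, cw i (y i)) * (∏ i, cw i (x i)) * (if R y x then (1:ℝ) else 0))]
  -- termwise comparison with the σ-reindexed right-hand side, then reindex
  have step : ∀ q : (α → Bool) × (α → Bool),
      (∏ i, cw i (q.1 i)) * (∏ i, cw i (q.2 i)) * (if L q.1 q.2 then (1:ℝ) else 0) ≤
        (∏ i, cw i ((σ q).1 i)) * (∏ i, cw i ((σ q).2 i)) * (if R (σ q).1 (σ q).2 then (1:ℝ) else 0) := by
    intro q
    rw [hσ]
    simp only [σf]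
    rw [pairWeight_swap cw P q.1 q.2]
    have hg : 0 ≤ (∏ i, cw i (q.1 i)) * ∏ i, cw i (q.2 i) :=
      mul_nonneg (Finset.prod_nonneg fun i _ => hcw i _) (Finset.prod_nonneg fun i _ => hcw i _)
    by_cases hL : L q.1 q.2
    · have hR := h q.1 q.2 hL
      simp only [hL, hR, if_true]
      exact le_refl _
    · simp only [hL, if_false, mul_zero]
      split_ifs
      · simpa using hg
      · simp
  calc ∑ q : (α → Bool) × (α → Bool),
        (∏ i, cw i (q.1 i)) * (∏ i, cw i (q.2 i)) * (if L q.1 q.2 then (1:ℝ) else 0)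
      ≤ ∑ q : (α → Bool) × (α → Bool),
        (∏ i, cw i ((σ q).1 i)) * (∏ i, cw i ((σ q).2 i)) * (if R (σ q).1 (σ q).2 then (1:ℝ) else 0) :=
        Finset.sum_le_sum fun q _ => step q
    _ = ∑ q : (α → Bool) × (α → Bool),
        (∏ i, cw i (q.1 i)) * (∏ i, cw i (q.2 i)) * (if R q.1 q.2 then (1:ℝ) else 0) :=
        Equiv.sum_comp σ (fun q : (α → Bool) × (α → Bool) =>
          (∏ i, cw i (q.1 i)) * (∏ i, cw i (q.2 i)) * (if R q.1 q.2 then (1:ℝ) else 0))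

end Swap

/-! ### Transport to `prodBernoulli` -/

section Transport

variable {ι : Type*}

/-- **Pair inequality for `prodBernoulli` from a swap on patterns.**  For events `S₁, S₂, T₁, T₂` determined by a
finite set `F` and a set of coordinates `P`: if for all patterns `y, x ∈ {0,1}^F` with `{y} ∈ S₁`, `{x} ∈ S₂` the swapped
patterns (`x` on `P`, `y` off `P`; and conversely) satisfy `{·} ∈ T₁` resp. `{·} ∈ T₂`, then
`P(S₁) P(S₂) ≤ P(T₁) P(T₂)` for every parameter vector. [this file] -/
theorem prodBernoulli_pair_le_of_swap (p : ι → unitInterval) (F : Finset ι) (P : F → Prop) [DecidablePred P]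
    {S₁ S₂ T₁ T₂ : Set (Set ι)}
    (hS₁ : DeterminedBy S₁ (↑F : Set ι)) (hS₂ : DeterminedBy S₂ (↑F : Set ι))
    (hT₁ : DeterminedBy T₁ (↑F : Set ι)) (hT₂ : DeterminedBy T₂ (↑F : Set ι))
    (h : ∀ y x : F → Bool,
      {i : ι | ∃ hi : i ∈ F, y ⟨i, hi⟩ = true} ∈ S₁ → {i : ι | ∃ hi : i ∈ F, x ⟨i, hi⟩ = true} ∈ S₂ →
        {i : ι | ∃ hi : i ∈ F, (fun j => if P j then x j else y j) ⟨i, hi⟩ = true} ∈ T₁ ∧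
          {i : ι | ∃ hi : i ∈ F, (fun j => if P j then y j else x j) ⟨i, hi⟩ = true} ∈ T₂) :
    (prodBernoulli p).real S₁ * (prodBernoulli p).real S₂ ≤
      (prodBernoulli p).real T₁ * (prodBernoulli p).real T₂ := by
  classical
  rw [prodBernoulli_real_eq_sum_cube p F hS₁, prodBernoulli_real_eq_sum_cube p F hS₂,
    prodBernoulli_real_eq_sum_cube p F hT₁, prodBernoulli_real_eq_sum_cube p F hT₂]
  -- the weight
  set cw : F → Bool → ℝ := fun i t => if t = true then ((p i : unitInterval) : ℝ) else 1 - ((p i : unitInterval) : ℝ)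
    with hcw_def
  have hcw : ∀ i t, 0 ≤ cw i t := by
    intro i t
    simp only [hcw_def]
    split_ifs
    · exact (p i).2.1
    · exact sub_nonneg.2 (p i).2.2
  have hg : ∀ a : F → Bool, (∏ i : F, (if a i = true then ((p i : unitInterval) : ℝ) else 1 - ((p i : unitInterval) : ℝ)))
      = ∏ i, cw i (a i) := fun a => rfl
  -- products of indicator sums as pair sums
  have key : ∀ (A B : Set (Set ι)),
      (∑ a : F → Bool, ({a : F → Bool | {i : ι | ∃ hi : i ∈ F, a ⟨i, hi⟩ = true} ∈ A}).indicator
          (fun a => ∏ i : F, (if a i = true then ((p i : unitInterval) : ℝ) else 1 - ((p i : unitInterval) : ℝ))) a) *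
        (∑ a : F → Bool, ({a : F → Bool | {i : ι | ∃ hi : i ∈ F, a ⟨i, hi⟩ = true} ∈ B}).indicator
          (fun a => ∏ i : F, (if a i = true then ((p i : unitInterval) : ℝ) else 1 - ((p i : unitInterval) : ℝ))) a) =
      ∑ y : F → Bool, ∑ x : F → Bool, (∏ i, cw i (y i)) * (∏ i, cw i (x i)) *
        (if ({i : ι | ∃ hi : i ∈ F, y ⟨i, hi⟩ = true} ∈ A ∧ {i : ι | ∃ hi : i ∈ F, x ⟨i, hi⟩ = true} ∈ B)
          then 1 else 0) := by
    intro A B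
    rw [Finset.sum_mul_sum]
    refine Finset.sum_congr rfl fun y _ => Finset.sum_congr rfl fun x _ => ?_
    simp only [Set.indicator, Set.mem_setOf_eq, hg]
    by_cases hy : {i : ι | ∃ hi : i ∈ F, y ⟨i, hi⟩ = true} ∈ A <;>
      by_cases hx : {i : ι | ∃ hi : i ∈ F, x ⟨i, hi⟩ = true} ∈ B <;> simp [hy, hx]
  rw [key S₁ S₂, key T₁ T₂]
  refine sum_pair_le_of_swap cw hcw P _ _ ?_
  intro y x hL
  exact h y x hL.1 hL.2

end Transport

/-! ### RC1 on Steiner-free supports -/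

section SteinerFree

variable {n : ℕ}

/-- Events on `Fin n` are determined by the full coordinate set. [folklore] -/
theorem determinedBy_coe_univ (C : Set (Set (Sym2 (Fin n)))) :
    DeterminedBy C (↑(Finset.univ : Finset (Sym2 (Fin n))) : Set (Sym2 (Fin n))) := by
  rw [determinedBy_iff]
  intro ω ω' h
  rw [Finset.coe_univ, Set.inter_univ, Set.inter_univ] at h
  rw [h]

/-- Reading the swapped pattern as a hybrid configuration: with `P e = (o ∉ e)`, the configuration of the pattern
"`x` on `P`, `y` off `P`" consists of the edges at `o` of `{y}` and the other edges of `{x}`. [this file] -/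
theorem mem_cfg_swap (o : Fin n) (y x : ↥(Finset.univ : Finset (Sym2 (Fin n))) → Bool) (e : Sym2 (Fin n)) :
    e ∈ {i : Sym2 (Fin n) | ∃ hi : i ∈ (Finset.univ : Finset (Sym2 (Fin n))),
        (fun j : ↥(Finset.univ : Finset (Sym2 (Fin n))) => if o ∉ (j : Sym2 (Fin n)) then x j else y j) ⟨i, hi⟩ = true} ↔
      (o ∈ e ∧ e ∈ {i : Sym2 (Fin n) | ∃ hi : i ∈ (Finset.univ : Finset (Sym2 (Fin n))), y ⟨i, hi⟩ = true}) ∨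
        (o ∉ e ∧ e ∈ {i : Sym2 (Fin n) | ∃ hi : i ∈ (Finset.univ : Finset (Sym2 (Fin n))), x ⟨i, hi⟩ = true}) := by
  simp only [Set.mem_setOf_eq, Finset.mem_univ, exists_true_left]
  by_cases ho : o ∈ e <;> simp [ho]

/-- **RC1 on Steiner-free supports (THEOREM).**  If every vertex is `o`, `a`, `b` or a core vertex (`a, b ≠ o`,
`a, b ∉ R`, `c ∈ R`), then for every weight vector, with `Γ = ⋂_{r ∈ R} {c ↔ r}`:
`μ(Γ ∩ {o↮a} ∩ {o↮c} ∩ {o↔b}) · μ(Γ ∩ {o↮b} ∩ {o↮c} ∩ {o↔a}) ≤ μ(Γ ∩ {o↮a} ∩ {a↮c}) · μ(Γ ∩ {o↮b} ∩ {b↮c})` —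
the random-core pair exchange `S_a S_b ≤ T_a T_b`, in exactly the shape of the hypothesis `hRC1` of
`CoreExchange.eventGluing_pair_within` and `CoreExchange.worstFirst_two_mul_within` (so REG₂ and RWF₂ follow on such
supports); for `R = {c}` it is `Theorems.worstPairExchange_two`. [this file] -/
theorem steinerFree_corePairExchange (w : Sym2 (Fin n) → unitInterval) (o a b c : Fin n) (R : Finset (Fin n))
    (hV : ∀ v, v = o ∨ v = a ∨ v = b ∨ v ∈ R) (hao : a ≠ o) (hbo : b ≠ o) (haR : a ∉ R) (hbR : b ∉ R)
    (hcR : c ∈ R) :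
    (prodBernoulli w).real ((⋂ r ∈ R, (openConn c r : Set (BondConfig (Fin n)))) ∩
          (openConn o a : Set (BondConfig (Fin n)))ᶜ ∩ (openConn o c)ᶜ ∩ openConn o b) *
        (prodBernoulli w).real ((⋂ r ∈ R, (openConn c r : Set (BondConfig (Fin n)))) ∩
          (openConn o b : Set (BondConfig (Fin n)))ᶜ ∩ (openConn o c)ᶜ ∩ openConn o a) ≤
      (prodBernoulli w).real ((⋂ r ∈ R, (openConn c r : Set (BondConfig (Fin n)))) ∩
          (openConn o a : Set (BondConfig (Fin n)))ᶜ ∩ (openConn a c)ᶜ) *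
        (prodBernoulli w).real ((⋂ r ∈ R, (openConn c r : Set (BondConfig (Fin n)))) ∩
          (openConn o b : Set (BondConfig (Fin n)))ᶜ ∩ (openConn b c)ᶜ) := by
  classical
  have memΓ : ∀ ω : BondConfig (Fin n), ω ∈ (⋂ r ∈ R, (openConn c r : Set (BondConfig (Fin n)))) ↔
      ∀ r ∈ R, (openGraph ω).Reachable c r := fun ω => by
    simp only [Set.mem_iInter]; rfl
  have hV' : ∀ v, v = o ∨ v = b ∨ v = a ∨ v ∈ R := fun v => by
    rcases hV v with h | h | h | h
    · exact Or.inl h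
    · exact Or.inr (Or.inr (Or.inl h))
    · exact Or.inr (Or.inl h)
    · exact Or.inr (Or.inr (Or.inr h))
  refine prodBernoulli_pair_le_of_swap w Finset.univ (fun j => o ∉ (j : Sym2 (Fin n)))
    (determinedBy_coe_univ _) (determinedBy_coe_univ _) (determinedBy_coe_univ _) (determinedBy_coe_univ _) ?_
  intro y x hy hx
  -- unpack the two configurations
  obtain ⟨⟨⟨hΓ1, h1oa⟩, h1oc⟩, h1ob⟩ := hy
  obtain ⟨⟨⟨hΓ2, h2ob⟩, h2oc⟩, h2oa⟩ := hx
  rw [memΓ] at hΓ1 hΓ2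
  change ¬ (openGraph _).Reachable o a at h1oa
  change ¬ (openGraph _).Reachable o c at h1oc
  change (openGraph _).Reachable o b at h1ob
  change ¬ (openGraph _).Reachable o b at h2ob
  change ¬ (openGraph _).Reachable o c at h2oc
  change (openGraph _).Reachable o a at h2oa
  -- the two hybrids
  have hη₁ := mem_cfg_swap o y x
  have hη₂ := mem_cfg_swap o x y
  obtain ⟨hΓη₁, hoaη₁, hacη₁⟩ := hybrid_mem_T (R := R) hV hao haR hcR hη₁ h1oa h2oa h2ob h2oc hΓ2
  obtain ⟨hΓη₂, hobη₂, hbcη₂⟩ := hybrid_mem_T (R := R) hV' hbo hbR hcR hη₂ h2ob h1ob h1oa h1oc hΓ1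
  exact ⟨⟨⟨(memΓ _).2 hΓη₁, hoaη₁⟩, hacη₁⟩, ⟨⟨(memΓ _).2 hΓη₂, hobη₂⟩, hbcη₂⟩⟩

/-! ### Beyond Steiner-free: it suffices that the open edges of the first copy at `o` end at terminals
(then no entangled Steiner vertex can occur; the measure-level consequences — RC1 on the event "every open edge at
`o` ends at a terminal", and RC1 for weights vanishing on the edges from `o` to non-terminals — are one application
of `prodBernoulli_pair_le_of_swap` away, seat memo batch 6 addendum). -/


/-- **The hybrid lands in `T_a`, general vertex set.**  Hypotheses as in `hybrid_mem_T` but, instead of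
Steiner-freeness, only: every open edge of `ω₁` at `o` ends at `a`, `b` or a core vertex.  Then in the hybrid `η`
(edges at `o` from `ω₁`, the others from `ω₂`): the core literal holds, `o ↮ a` and `a ↮ c`.  Proof: every vertex
reached from `a` in `η` is reached from `a` in `ω₂` and is not `o` (induction on the walk: a step into `o` would use an
open `ω₁`-edge `x–o` with `x ∈ C_{ω₂}(a) = C_{ω₂}(o)` a terminal, impossible). [this file] -/
theorem hybrid_mem_T_of_terminalNbrs {V : Type*} {ω₁ ω₂ η : BondConfig V} {o a b c : V} {R : Finset V}
    (hao : a ≠ o) (hN : ∀ z, z ≠ o → s(o, z) ∈ ω₁ → (z = a ∨ z = b ∨ z ∈ R))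
    (hη : ∀ e, e ∈ η ↔ (o ∈ e ∧ e ∈ ω₁) ∨ (o ∉ e ∧ e ∈ ω₂))
    (h1oa : ¬ (openGraph ω₁).Reachable o a)
    (h2oa : (openGraph ω₂).Reachable o a) (h2ob : ¬ (openGraph ω₂).Reachable o b)
    (h2oc : ¬ (openGraph ω₂).Reachable o c) (h2Γ : ∀ r ∈ R, (openGraph ω₂).Reachable c r) :
    (∀ r ∈ R, (openGraph η).Reachable c r) ∧ ¬ (openGraph η).Reachable o a ∧
      ¬ (openGraph η).Reachable a c := by
  -- the core transfers
  have hco : ¬ (openGraph ω₂).Reachable c o := fun h => h2oc h.symm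
  have hΓ : ∀ r ∈ R, (openGraph η).Reachable c r := fun r hr =>
    reach_transfer_of_avoids hco (fun e he ho => (hη e).2 (Or.inr ⟨ho, he⟩)) (h2Γ r hr)
  -- what `a` reaches in `η` it reaches in `ω₂`, and it never reaches `o`
  have key : ∀ v, (openGraph η).Reachable a v → (openGraph ω₂).Reachable a v ∧ v ≠ o := by
    intro v hv
    rw [SimpleGraph.reachable_iff_reflTransGen] at hv
    induction hv with
    | refl => exact ⟨SimpleGraph.Reachable.refl a, hao⟩
    | @tail x y _ hxy ih =>
      obtain ⟨hax, hxo⟩ := ih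
      obtain ⟨he, hne⟩ := (openGraph_adj η x y).1 hxy
      rcases (hη _).1 he with ⟨ho, he1⟩ | ⟨ho, he2⟩
      · -- a step into `o` along an open `ω₁`-edge: `x` would be a terminal in `C_{ω₂}(o)`
        exfalso
        have hyo : y = o := by
          rcases Sym2.mem_iff.1 ho with h | h
          · exact absurd h.symm hxo
          · exact h.symm
        have hox : s(o, x) ∈ ω₁ := by rw [Sym2.eq_swap, ← hyo]; exact he1
        rcases hN x hxo hox with hx | hx | hx
        · have hr : (openGraph ω₁).Reachable x y := ((openGraph_adj ω₁ x y).2 ⟨he1, hne⟩).reachable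
          rw [hx, hyo] at hr
          exact h1oa hr.symm
        · rw [hx] at hax
          exact h2ob (h2oa.trans hax)
        · exact h2oc ((h2oa.trans hax).trans (h2Γ x hx).symm)
      · exact ⟨hax.trans ((openGraph_adj ω₂ x y).2 ⟨he2, hne⟩).reachable,
          fun hyo => ho (by rw [hyo]; exact Sym2.mem_mk_right x o)⟩
  refine ⟨hΓ, fun h => (key o h.symm).2 rfl, fun h => h2oc (h2oa.trans (key c h).1)⟩

end SteinerFree

end CoreExchange

end Summit.CriticalPhenomena.PercolationContinuityZ3.Theorems

end
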